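import Literature.IUT.HodgeArakelov.PlusMinusTowerRamifiedCuspOfUnderline
import Literature.IUT.HodgeArakelov.LabelClassesOfCuspsRmk231Genuine
import Literature.IUT.HodgeArakelov.TemperedCurveXu
import HarnessLib

/-!
# [IUTchII] Def 2.3 (i): `Def23_i_indices` at the genuine setting — input (v) «`I_x ⊆ Π^tp_{X̲}`» and `hDopen` DISCHARGED (proof-only knit)

S. Mochizuki, *Inter-universal Teichmüller theory II*, kurims manuscript (Dec. 2020), §2, Def. 2.3 (i) p. 67 («natural isomorphisms
`Π^±_{v•}/Π_{v•} ⥲ Π^±_{v▶}/Π_{v▶} ⥲ Π^±_v/Π_v ⥲ Δ̂^±_v/Δ̂_v ⥲ Gal(X̲̲_v/X̲_v) (≅ ℤ/lℤ)` and equalities `Π^±_{v□} ∩ Π_v = Π_{v□}` [cf. [IUTchI] Cor 2.3 (iv)]»)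
([IUTchII] Def 2.3 (i), kurims p.67) [claim: Mochizuki2012, status: disputed]; pages = kurims preprint render IUTchII-kurims-url-5036b4059555.
[EtTh] §1 p. 12 («`Π^tp_Y = Ker(Π^tp_X ↠ Z)`»), §2 p. 35 [cite: MochizukiEtTh2009, §2 p.35]; [SemiAnbd] §6 p. 71 [cite: MochizukiSemiAnbd2006, §6 p.71].
abc-iut cell, layer L6, seat abc-iut-L6-t19 (gen 6), row «DEF23i-LINE» (lead §F v1.19at (5)); BY-NAME knit over abc-iut-w5-d132's
`def23_i_indices_ofUnderline_of_cusps` (p441662).  PROOF-ONLY: no `def`, no `instance`, nothing landed is edited.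

WHAT IS DISCHARGED.  p441662 proves abc-iut-L6-t1's `Def23_i_indices Dec W` over `BadPlaceSetting.ofUnderline` for EVERY tower `W` modulo the named
inputs (i) the MERGE identifications `htri`/`hbul`, (ii) [IUTchI] Cor 2.3 (iv)(vi) + `Cor23Hyp` of the two abc-iut-L5 data of `X̲_v`, (iii) the [EtTh] §2
clause «`toTheta(I_x) = Δ_Θ`» at the underlying cusps, (iv) a cyclotome `μ₁ : CyclotomeMod 1 l`, (v) «`I_x ⊆ Π^tp_{X̲}`» (`hIxtri`/`hIxbul`), (vi) `hN`, the
openness `hDopen` of the images in `G_K` of the decomposition groups of `X̲_v`, and the special-fibre DATA.  Here (v) and `hDopen` are REMOVED: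
* (v) is a THEOREM for every cusp of ANY `ThetaSetting` — `ThetaSetting.inertia_le_GtpY` (p444107: `I_x ≅ Ẑ` is compact, `Z` is discrete ⇒
  `I_x ⊆ Π^tp_Y`) and `GtpY_le_GtpXu` (`Π^tp_Y ⊆ Π^tp_{X̲}`);
* `hDopen` is abc-iut-L6-t7's `temperedCurveXuOfLevelData` form (openness of `D_y ↠ G_K` from the compactness of the `D_x`, `GroupLevelData`), the
  special-fibre data being taken over that curve — the SAME parameter bundle the genuine agreements (p434636, p441069) use;
* (iii) is taken in the uniform shape `hC3 : ∀ cusps x of X, toTheta(I_x) = Δ_Θ` (class-R [EtTh] §2 clause, G-L2t10-3 family; abc-iut-L2-t7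
  `ThetaSetting.CuspLaws.map_toTheta_inertia`; discharged from the commutator axis by abc-iut-w5-d165).
So `def23_i_indices_ofUnderline_of_levelData` = `Def23_i_indices Dec W` over `ofUnderline` for every `W` modulo EXACTLY ⟨(i) htri/hbul, (ii) Cor23Hyp +
Cor 2.3 (iv)(vi) ×2, (iii) hC3, (iv) μ₁, (vi) hN + `d : GroupLevelData` + special-fibre DATA⟩.  Nothing of the series is asserted; typed ≠ proved; no side
taken on [IUTchIII] Cor 3.12.
-/

noncomputable section

namespace Literature.IUT.HodgeArakelov

open Literature.AnabelianGeometry.EtaleTheta Literature.AnabelianGeometry.SemiGraphs Literature.IUT.HodgeTheaters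

namespace PlusMinusTower

variable {p : ℕ} [Fact p.Prime] {M : MuTwoSetting p}
  {E : M.toThetaSetting.EtaleThetaData} {l : ℕ} (C : E.DoubleUnderline l) {N : ℕ+}
  (μ : M.toThetaSetting.CyclotomeMod l N) (hC : M.toThetaSetting.Compat) (hS : M.toThetaSetting.Sec2Hyps)
  (hl : l.Prime) (hp2 : p ≠ 2) (hpl : p ≠ l) (hζ : ∃ ζ : M.toThetaSetting.K, IsPrimitiveRoot ζ (4 * l))
  {η : (C.thetaEnvData μ hC hS).PiYdd → MuN p N} (hη : η ∈ (C.thetaEnvData μ hC hS).thetaCocycles)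
  {P : TopGroup.{0}} (T : TemperedCoverings (BadPlaceSetting.ofUnderline C μ hC hS hl hp2 hpl hζ hη) P)
  (d : M.toTemperedCurve.GroupLevelData)
  (Sf : SpecialFibreData ((M.toThetaSetting.temperedCurveXuOfLevelData l C.l_ne_zero d).toTemperedArithmeticGroup
    (M.toThetaSetting.groupLevelDataXu l C.l_ne_zero d)))
  (h36 : Sf.Gc.Prop36Hypotheses) (Sigma SigmaHat : Set ℕ) (hsub : Sigma ⊆ SigmaHat) (hne : Sigma.Nonempty)
  (hprime : ∀ q ∈ SigmaHat, q.Prime) (hp : p ∉ Sigma)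
  (TpHtri TpHbul : Subgroup Sf.chart.G)
  (HatHtri HatHbul : Subgroup (TemperedGraphGroupData.exists_completion_of_prop36 Sf.Gc h36 Sf.chart).choose)
  (hletri : TpHtri.map (TemperedGraphGroupData.exists_completion_of_prop36 Sf.Gc h36 Sf.chart).choose_spec.choose.toMonoidHom ≤ HatHtri)
  (hlebul : TpHbul.map (TemperedGraphGroupData.exists_completion_of_prop36 Sf.Gc h36 Sf.chart).choose_spec.choose.toMonoidHom ≤ HatHbul)
  (cMHtri cMHbul : {x : (M.toThetaSetting.temperedCurveXuOfLevelData l C.l_ne_zero d).Pt //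
    (M.toThetaSetting.temperedCurveXuOfLevelData l C.l_ne_zero d).IsCusp x} → Prop)

/-- **IUTchII:Def2.3(i)** (kurims p.67) **`Def23_i_indices Dec W` at the genuine setting, input (v) and `hDopen` discharged.**  Over
`BadPlaceSetting.ofUnderline`, for EVERY tower `W` and every `Dec` whose `Π_{v▶}`, `Π_{v•}` are cut out through `plainIso` by two of abc-iut-L5's data
`ofSpecialFibre` of abc-iut-L6-t7's curve `X̲_v = temperedCurveXuOfLevelData …` (identifications `htri`, `hbul`), MODULO per sub-graph `Cor23Hyp`,
[IUTchI] Cor 2.3 (iv), (vi) and a cusp meeting it, the class-R [EtTh] §2 clause `hC3 : toTheta(I_x) = Δ_Θ` at the cusps of `X`, ONE cyclotome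
`μ₁ : CyclotomeMod 1 l` (the natural `Δ_Θ ↠ μ_l` with kernel the `l`-th powers, [EtTh] pp. 12, 46) and the tower's `hN`: the three conjuncts
`[Π^±_{v•} : Π_{v•}] = [Π^±_{v▶} : Π_{v▶}] = [Π^±_v : Π_v] = l`.  PROVED — abc-iut-w5-d132's `def23_i_indices_ofUnderline_of_cusps` (p441662) with its
input «`I_x ⊆ Π^tp_{X̲}`» supplied by `ThetaSetting.inertia_le_GtpY` + `GtpY_le_GtpXu` and its `hDopen` by the `GroupLevelData` form.
[claim: Mochizuki2012, status: disputed] -/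
theorem def23_i_indices_ofUnderline_of_levelData (hN : (C.Huu.subgroupOf (M.GtpXu l)).Normal)
    (hC3 : ∀ x : M.toTemperedCurve.Pt, M.toTemperedCurve.IsCusp x →
      (M.toTemperedCurve.inertia x).map M.toThetaSetting.toTheta = M.toThetaSetting.DeltaTheta)
    {E' : HodgeArakelov.EtaleThetaData (BadPlaceSetting.ofUnderline C μ hC hS hl hp2 hpl hζ hη).toThetaSetting P}
    (Dec : SubgraphDecomposition (BadPlaceSetting.ofUnderline C μ hC hS hl hp2 hpl hζ hη) T E') (W : PlusMinusTower T)
    (htri : Dec.Ptri = ((StableCurveTemperedData.ofSpecialFibre (M.toThetaSetting.temperedCurveXuOfLevelData l C.l_ne_zero d)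
      (M.toThetaSetting.groupLevelDataXu l C.l_ne_zero d) Sf h36 Sigma SigmaHat hsub hne hprime hp TpHtri HatHtri hletri
      cMHtri).piTpXH.comap T.plainIso.toMulEquiv.toMonoidHom).comap T.incl)
    (hbul : Dec.Pbullet = ((StableCurveTemperedData.ofSpecialFibre (M.toThetaSetting.temperedCurveXuOfLevelData l C.l_ne_zero d)
      (M.toThetaSetting.groupLevelDataXu l C.l_ne_zero d) Sf h36 Sigma SigmaHat hsub hne hprime hp TpHbul HatHbul hlebul
      cMHbul).piTpXH.comap T.plainIso.toMulEquiv.toMonoidHom).comap T.incl)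
    {lpos : ℕ+} (hlpos : (lpos : ℕ) = l) (μ₁ : M.toThetaSetting.CyclotomeMod 1 lpos)
    (hHyptri : (StableCurveTemperedData.ofSpecialFibre (M.toThetaSetting.temperedCurveXuOfLevelData l C.l_ne_zero d)
      (M.toThetaSetting.groupLevelDataXu l C.l_ne_zero d) Sf h36 Sigma SigmaHat hsub hne hprime hp TpHtri HatHtri hletri cMHtri).Cor23Hyp)
    (h23ivtri : (StableCurveTemperedData.ofSpecialFibre (M.toThetaSetting.temperedCurveXuOfLevelData l C.l_ne_zero d)
      (M.toThetaSetting.groupLevelDataXu l C.l_ne_zero d) Sf h36 Sigma SigmaHat hsub hne hprime hp TpHtri HatHtri hletri cMHtri).Cor23iv)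
    (h23vitri : (StableCurveTemperedData.ofSpecialFibre (M.toThetaSetting.temperedCurveXuOfLevelData l C.l_ne_zero d)
      (M.toThetaSetting.groupLevelDataXu l C.l_ne_zero d) Sf h36 Sigma SigmaHat hsub hne hprime hp TpHtri HatHtri hletri cMHtri).Cor23vi)
    (ytri : (StableCurveTemperedData.ofSpecialFibre (M.toThetaSetting.temperedCurveXuOfLevelData l C.l_ne_zero d)
      (M.toThetaSetting.groupLevelDataXu l C.l_ne_zero d) Sf h36 Sigma SigmaHat hsub hne hprime hp TpHtri HatHtri hletri cMHtri).Cusp)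
    (hytri : (StableCurveTemperedData.ofSpecialFibre (M.toThetaSetting.temperedCurveXuOfLevelData l C.l_ne_zero d)
      (M.toThetaSetting.groupLevelDataXu l C.l_ne_zero d) Sf h36 Sigma SigmaHat hsub hne hprime hp TpHtri HatHtri hletri
      cMHtri).cuspMeetsH ytri)
    (hHypbul : (StableCurveTemperedData.ofSpecialFibre (M.toThetaSetting.temperedCurveXuOfLevelData l C.l_ne_zero d)
      (M.toThetaSetting.groupLevelDataXu l C.l_ne_zero d) Sf h36 Sigma SigmaHat hsub hne hprime hp TpHbul HatHbul hlebul cMHbul).Cor23Hyp)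
    (h23ivbul : (StableCurveTemperedData.ofSpecialFibre (M.toThetaSetting.temperedCurveXuOfLevelData l C.l_ne_zero d)
      (M.toThetaSetting.groupLevelDataXu l C.l_ne_zero d) Sf h36 Sigma SigmaHat hsub hne hprime hp TpHbul HatHbul hlebul cMHbul).Cor23iv)
    (h23vibul : (StableCurveTemperedData.ofSpecialFibre (M.toThetaSetting.temperedCurveXuOfLevelData l C.l_ne_zero d)
      (M.toThetaSetting.groupLevelDataXu l C.l_ne_zero d) Sf h36 Sigma SigmaHat hsub hne hprime hp TpHbul HatHbul hlebul cMHbul).Cor23vi)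
    (ybul : (StableCurveTemperedData.ofSpecialFibre (M.toThetaSetting.temperedCurveXuOfLevelData l C.l_ne_zero d)
      (M.toThetaSetting.groupLevelDataXu l C.l_ne_zero d) Sf h36 Sigma SigmaHat hsub hne hprime hp TpHbul HatHbul hlebul cMHbul).Cusp)
    (hybul : (StableCurveTemperedData.ofSpecialFibre (M.toThetaSetting.temperedCurveXuOfLevelData l C.l_ne_zero d)
      (M.toThetaSetting.groupLevelDataXu l C.l_ne_zero d) Sf h36 Sigma SigmaHat hsub hne hprime hp TpHbul HatHbul hlebul
      cMHbul).cuspMeetsH ybul) :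
    Def23_i_indices Dec W := by
  haveI : (M.GtpXu l).FiniteIndex := ⟨by rw [M.toThetaSetting.index_GtpXu l]; exact C.l_ne_zero⟩
  haveI : FiniteDimensional ℚ_[p] M.K := M.toThetaSetting.finiteDimensional_K
  exact def23_i_indices_ofUnderline_of_cusps C μ hC hS hl hp2 hpl hζ hη T hN
    (M.toTemperedCurve.hDopen_of_isCompact_decomp (M.GtpXu l) (M.toThetaSetting.isOpen_GtpXu l)
      (M.toTemperedCurve.decompCompact_of_groupLevelData d))
    (M.toThetaSetting.groupLevelDataXu l C.l_ne_zero d) Sf h36 Sigma SigmaHat hsub hne hprime hp TpHtri TpHbul HatHtri HatHbul hletri hlebul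
    cMHtri cMHbul Dec W htri hbul hlpos μ₁ hHyptri h23ivtri h23vitri ytri hytri (hC3 ytri.1.1 ytri.2)
    ((M.toThetaSetting.inertia_le_GtpY ytri.2).trans (M.toThetaSetting.GtpY_le_GtpXu l))
    hHypbul h23ivbul h23vibul ybul hybul (hC3 ybul.1.1 ybul.2)
    ((M.toThetaSetting.inertia_le_GtpY ybul.2).trans (M.toThetaSetting.GtpY_le_GtpXu l))

end PlusMinusTower

end Literature.IUT.HodgeArakelov

end
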